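import Summits.NavierStokesRegularity.FluidComputer.TubeTablePost13
import HarnessLib

/-!
# Kernel run of the post-ramp box tube, chunks 0 … 5 (bp3 gen 16)

HONEST FRAMING: low prior, high value-of-information experiment on Tao's machine paradigm; NOT a
claim that NS blows up.

Kernel evaluations (`decide +kernel`; no `native_decide`, no extra axioms) of the in-tree tube checker
`runTube` (`P = 60`, 12 Taylor terms, cube `Rt`, read-out `CLt`) on the chunks `cP13 0 … cP13 5`
(= design chunks `cT 13 … cT 18`) of `TubeTablePost13.lean`, each from the recorded boundary
state `sP13 i` to `sP13 (i+1)`.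

[cite: Tao2016AveragedNS, §5.5 Thm 5.3 (5.5)]
-/

namespace Summit.NavierStokesRegularity.FluidComputer

namespace TubeTablePost13

open Literature.Analysis.FluidPDE.FluidComputer Literature.Analysis.FluidPDE.FluidComputer.TubeTable
open Literature.Analysis.FluidPDE.FluidComputer.ThresholdLevelTable (GIt)

set_option maxHeartbeats 10000000 in
set_option maxRecDepth 200000 in
/-- Chunk 0 of the post-ramp tube run (design chunk 13: 50 steps at `h = 2^-11`). [folklore] -/
theorem runP13_0 : runTube 60 12 GIt CLt Rt (sP13 0) (cP13 0) = some (sP13 (0 + 1)) := by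
  decide +kernel

set_option maxHeartbeats 10000000 in
set_option maxRecDepth 200000 in
/-- Chunk 1 of the post-ramp tube run (design chunk 14: 50 steps at `h = 2^-11`). [folklore] -/
theorem runP13_1 : runTube 60 12 GIt CLt Rt (sP13 1) (cP13 1) = some (sP13 (1 + 1)) := by
  decide +kernel

set_option maxHeartbeats 10000000 in
set_option maxRecDepth 200000 in
/-- Chunk 2 of the post-ramp tube run (design chunk 15: 50 steps at `h = 2^-11`). [folklore] -/
theorem runP13_2 : runTube 60 12 GIt CLt Rt (sP13 2) (cP13 2) = some (sP13 (2 + 1)) := by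
  decide +kernel

set_option maxHeartbeats 10000000 in
set_option maxRecDepth 200000 in
/-- Chunk 3 of the post-ramp tube run (design chunk 16: 50 steps at `h = 2^-11`). [folklore] -/
theorem runP13_3 : runTube 60 12 GIt CLt Rt (sP13 3) (cP13 3) = some (sP13 (3 + 1)) := by
  decide +kernel

set_option maxHeartbeats 10000000 in
set_option maxRecDepth 200000 in
/-- Chunk 4 of the post-ramp tube run (design chunk 17: 50 steps at `h = 2^-11`). [folklore] -/
theorem runP13_4 : runTube 60 12 GIt CLt Rt (sP13 4) (cP13 4) = some (sP13 (4 + 1)) := by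
  decide +kernel

set_option maxHeartbeats 10000000 in
set_option maxRecDepth 200000 in
/-- Chunk 5 of the post-ramp tube run (design chunk 18: 50 steps at `h = 2^-11`). [folklore] -/
theorem runP13_5 : runTube 60 12 GIt CLt Rt (sP13 5) (cP13 5) = some (sP13 (5 + 1)) := by
  decide +kernel

end TubeTablePost13

end Summit.NavierStokesRegularity.FluidComputer
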